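import Mathlib
import HarnessLib

/-!
# Ornstein–Zernike ratio asymptotics force eventual strict lattice subharmonicity — preliminaries

Route `PerfectScreening`, crux r2 `SubharmonicOffOrigin` (stmt-CriticalPhenomena-1341), by-product
for the MASSIVE regime (Disproof §(c), STRATEGY-CENSUS §6 D4 / §8.4): an abstract, model-free
lemma of lattice analysis.

Let `ξ : ℝ^d → ℝ` be positively homogeneous of degree one, strictly positive and `C¹` off the
origin (an "inverse correlation length" norm), and let `G, H : ℤ^d → ℝ` with `H > 0` eventually,
`H(x + eᵢ)/H(x) → 1` (a slowly varying prefactor) and `G(x) / (H(x) e^{-ξ(x)}) → 1` as `x → ∞`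
(Ornstein–Zernike-type asymptotics in RATIO form).  Then `G` is eventually UNIFORMLY STRICTLY
lattice-subharmonic: there is `c > 0` with

  `(2d + c)·G(x) ≤ ∑ᵢ (G(x + eᵢ) + G(x − eᵢ))`  for all but finitely many `x`

(`eventually_strictSubharmonic_of_ratioAsymptotics`, in the companion file
`PerfectScreeningSubharmonicOffOriginOZSubharmonic.lean`; this file holds the analytic
preliminaries: the compact annulus, Euler's identity, the uniform linearisation of `ξ`, the
hyperbolic-cosine gain of the stencil and the per-site inequality chain).  Mechanism: `ξ(x ± eᵢ) = ξ(x) ± ∂ᵢξ(x̂) + o(1)`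
uniformly (`C¹` + homogeneity: mean value inequality on a ball of radius `1/‖x‖` around the unit
vector `x̂`, where `∇ξ` is uniformly continuous), so `∑_{y∼x} G(y)/G(x) → ∑ᵢ 2cosh ∂ᵢξ(x̂) ≥
2d + |∇ξ(x̂)|²/… ≥ 2d + m²/(2d)` with `m = min_{‖u‖=1} ξ(u) > 0` by Euler's identity
`∇ξ(x̂)·x̂ = ξ(x̂)`.  The massive two-point function thus has an `O(m²)` subharmonicity margin at
infinity — in contrast with the critical point, where every uniform margin is refuted
(`Cruxes/SubharmonicOffOrigin/Disproof.lean`, `not_uniformlyStrictSubharmonic`).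

Everything here is elementary real analysis (Mathlib only); the Ising input enters in the companion
file `PerfectScreeningSubharmonicOffOriginMassiveRegime.lean` through the Campanino–Ioffe–Velenik
2003 Ornstein–Zernike theorem.
-/

noncomputable section

open Filter Topology Metric Set

namespace Summit.CriticalPhenomena.Ising3DConformalLimit.Theorems.PerfectScreening.OZSubharmonic

variable {d : ℕ}

/-! ### The unit sphere and a compact annulus of `ℝ^d` (sup norm) -/

/-- A point within sup-distance `1/2` of a unit vector has norm in `[1/2, 3/2]`. [folklore] -/
theorem norm_mem_annulus {u z : Fin d → ℝ} (hu : ‖u‖ = 1) (hz : ‖z - u‖ ≤ 1 / 2) :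
    1 / 2 ≤ ‖z‖ ∧ ‖z‖ ≤ 3 / 2 := by
  constructor
  · have h := norm_sub_norm_le u z
    rw [norm_sub_rev] at hz
    linarith
  · have h := norm_le_insert' z u
    linarith

/-- The closed annulus `{1/2 ≤ ‖y‖ ≤ 3/2}` of `ℝ^d` is compact. [folklore] -/
theorem isCompact_annulus :
    IsCompact {y : Fin d → ℝ | 1 / 2 ≤ ‖y‖ ∧ ‖y‖ ≤ 3 / 2} := by
  have h1 : {y : Fin d → ℝ | 1 / 2 ≤ ‖y‖ ∧ ‖y‖ ≤ 3 / 2} =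
      closedBall (0 : Fin d → ℝ) (3 / 2) ∩ {y | 1 / 2 ≤ ‖y‖} := by
    ext y
    simp [and_comm]
  rw [h1]
  exact (isCompact_closedBall _ _).inter_right (isClosed_le continuous_const continuous_norm)

/-- Uniform continuity near the unit sphere: a function continuous off the origin is uniformly
continuous on the compact annulus, hence `‖z − u‖ ≤ δ`, `‖u‖ = 1` forces `dist (f z) (f u) ≤ ε`. [folklore] -/
theorem sphere_uniform {F : Type*} [PseudoMetricSpace F] {f : (Fin d → ℝ) → F}
    (hf : ContinuousOn f {0}ᶜ) {ε : ℝ} (hε : 0 < ε) :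
    ∃ δ : ℝ, 0 < δ ∧ δ ≤ 1 / 2 ∧
      ∀ u z : Fin d → ℝ, ‖u‖ = 1 → ‖z - u‖ ≤ δ → dist (f z) (f u) ≤ ε := by
  set K : Set (Fin d → ℝ) := {y | 1 / 2 ≤ ‖y‖ ∧ ‖y‖ ≤ 3 / 2} with hK_def
  have hK : IsCompact K := isCompact_annulus
  have hK0 : K ⊆ {0}ᶜ := by
    intro y hy h0
    have h0' : y = 0 := h0
    rw [h0', hK_def] at hy
    simp only [mem_setOf_eq, norm_zero] at hy
    linarith [hy.1]
  have huc : UniformContinuousOn f K := hK.uniformContinuousOn_of_continuous (hf.mono hK0)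
  obtain ⟨δ₀, hδ₀, hδ⟩ := Metric.uniformContinuousOn_iff_le.1 huc ε hε
  refine ⟨min δ₀ (1 / 2), lt_min hδ₀ (by norm_num), min_le_right _ _, fun u z hu hz => ?_⟩
  have hzK : z ∈ K := norm_mem_annulus hu (hz.trans (min_le_right _ _))
  have huK : u ∈ K := by
    refine ⟨?_, ?_⟩ <;> rw [hu] <;> norm_num
  exact hδ z hzK u huK (by rw [dist_eq_norm]; exact hz.trans (min_le_left _ _))

/-! ### Positively homogeneous `C¹` functions: Euler's identity and uniform linearisation -/

/-- **Euler's identity** for a positively `1`-homogeneous function differentiable at `u`: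
`Dξ(u)·u = ξ(u)` (differentiate `t ↦ ξ(t u) = t ξ(u)` at `t = 1`). [folklore] -/
theorem fderiv_apply_self_of_homogeneous {ξ : (Fin d → ℝ) → ℝ}
    (hhom : ∀ c : ℝ, 0 < c → ∀ x, ξ (c • x) = c * ξ x)
    {u : Fin d → ℝ} (hu : DifferentiableAt ℝ ξ u) : fderiv ℝ ξ u u = ξ u := by
  have h1 : HasDerivAt (fun t : ℝ => ξ (t • u)) (fderiv ℝ ξ u u) 1 := by
    have hs : HasDerivAt (fun t : ℝ => t • u) u 1 := by
      simpa using (hasDerivAt_id (1 : ℝ)).smul_const u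
    have hξ : HasFDerivAt ξ (fderiv ℝ ξ u) ((fun t : ℝ => t • u) 1) := by
      simpa using hu.hasFDerivAt
    exact hξ.comp_hasDerivAt 1 hs
  have h2 : HasDerivAt (fun t : ℝ => ξ (t • u)) (ξ u) 1 := by
    have hlin : HasDerivAt (fun t : ℝ => t * ξ u) (ξ u) 1 := by
      simpa using (hasDerivAt_id (1 : ℝ)).mul_const (ξ u)
    refine hlin.congr_of_eventuallyEq ?_
    filter_upwards [eventually_gt_nhds (zero_lt_one : (0 : ℝ) < 1)] with t ht
    exact hhom t ht u
  exact h1.unique h2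

/-- **Uniform linearisation at infinity.** For `ξ` positively `1`-homogeneous and `C¹` off the
origin and a fixed increment `v`, `ξ(x + v) − ξ(x) − Dξ(x̂)(v) → 0` as `‖x‖ → ∞`, uniformly
(`x̂ = x/‖x‖`): by homogeneity the difference is `‖x‖·[ξ(x̂ + h) − ξ(x̂) − Dξ(x̂)h]` with
`h = v/‖x‖`, and the mean value inequality on the ball `B(x̂, ‖h‖)` with the uniform continuity of
`Dξ` on the annulus bounds the bracket by `o(1)·‖h‖`. [folklore] -/
theorem linearisation {ξ : (Fin d → ℝ) → ℝ}
    (hhom : ∀ c : ℝ, 0 < c → ∀ x, ξ (c • x) = c * ξ x) (hC1 : ContDiffOn ℝ 1 ξ {0}ᶜ)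
    (v : Fin d → ℝ) {ε : ℝ} (hε : 0 < ε) :
    ∃ R : ℝ, 0 < R ∧ ∀ x : Fin d → ℝ, R ≤ ‖x‖ →
      |ξ (x + v) - ξ x - fderiv ℝ ξ (‖x‖⁻¹ • x) v| ≤ ε := by
  have hO : IsOpen (({0} : Set (Fin d → ℝ))ᶜ) := isOpen_compl_singleton
  have hDc : ContinuousOn (fun y => fderiv ℝ ξ y) {0}ᶜ :=
    hC1.continuousOn_fderiv_of_isOpen hO le_rfl
  have hdiff : ∀ y : Fin d → ℝ, y ≠ 0 → DifferentiableAt ℝ ξ y := fun y hy =>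
    (hC1.differentiableOn one_ne_zero y hy).differentiableAt (hO.mem_nhds hy)
  set ε' : ℝ := ε / (‖v‖ + 1) with hε'_def
  have hv1 : 0 < ‖v‖ + 1 := by positivity
  have hε' : 0 < ε' := div_pos hε hv1
  obtain ⟨δ, hδ, hδhalf, hδu⟩ := sphere_uniform hDc hε'
  refine ⟨(‖v‖ + 1) / δ, by positivity, fun x hx => ?_⟩
  have hRpos : 0 < (‖v‖ + 1) / δ := by positivity
  have hxpos : 0 < ‖x‖ := lt_of_lt_of_le hRpos hx
  have hx0 : x ≠ 0 := norm_pos_iff.1 hxpos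
  set r : ℝ := ‖x‖ with hr
  set u : Fin d → ℝ := r⁻¹ • x with hu_def
  set h : Fin d → ℝ := r⁻¹ • v with hh_def
  have hu : ‖u‖ = 1 := by
    rw [hu_def, norm_smul, norm_inv, Real.norm_eq_abs, abs_of_pos hxpos, inv_mul_cancel₀ hxpos.ne']
  have hnh : ‖h‖ = ‖v‖ / r := by
    rw [hh_def, norm_smul, norm_inv, Real.norm_eq_abs, abs_of_pos hxpos, div_eq_inv_mul]
  have hhδ : ‖h‖ ≤ δ := by
    rw [hnh, div_le_iff₀ hxpos]
    have h1 : ‖v‖ + 1 ≤ δ * r := by rwa [div_le_iff₀' hδ] at hx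
    nlinarith [norm_nonneg v]
  -- the mean value inequality on the closed ball `B(u, ‖h‖)`
  have hball : ∀ z ∈ closedBall u ‖h‖, ‖z - u‖ ≤ δ := fun z hz => by
    rw [mem_closedBall, dist_eq_norm] at hz
    exact hz.trans hhδ
  have hball0 : ∀ z ∈ closedBall u ‖h‖, z ≠ 0 := fun z hz h0 => by
    have h := (norm_mem_annulus hu ((hball z hz).trans hδhalf)).1
    rw [h0, norm_zero] at h
    linarith
  have hMVT : ‖ξ (u + h) - ξ u - fderiv ℝ ξ u (u + h - u)‖ ≤ ε' * ‖u + h - u‖ :=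
    (convex_closedBall u ‖h‖).norm_image_sub_le_of_norm_fderiv_le' (𝕜 := ℝ) (f := ξ)
      (φ := fderiv ℝ ξ u) (C := ε')
      (fun z hz => hdiff z (hball0 z hz))
      (fun z hz => by
        have h1 := hδu u z hu (hball z hz)
        rwa [dist_eq_norm] at h1)
      (mem_closedBall_self (norm_nonneg _))
      (by rw [mem_closedBall, dist_eq_norm, add_sub_cancel_left])
  rw [add_sub_cancel_left] at hMVT
  -- undo the scaling
  have hxu : x = r • u := by
    rw [hu_def, smul_smul, mul_inv_cancel₀ hxpos.ne', one_smul]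
  have hvh : v = r • h := by
    rw [hh_def, smul_smul, mul_inv_cancel₀ hxpos.ne', one_smul]
  have hscale1 : ξ (x + v) = r * ξ (u + h) := by
    rw [hxu, hvh, ← smul_add, hhom r hxpos]
  have hscale2 : ξ x = r * ξ u := by
    conv_lhs => rw [hxu]
    rw [hhom r hxpos]
  have hscale3 : fderiv ℝ ξ u v = r * fderiv ℝ ξ u h := by
    conv_lhs => rw [hvh]
    rw [map_smul, smul_eq_mul]
  calc |ξ (x + v) - ξ x - fderiv ℝ ξ u v|
      = r * |ξ (u + h) - ξ u - fderiv ℝ ξ u h| := by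
        rw [hscale1, hscale2, hscale3, ← mul_sub, ← mul_sub, abs_mul, abs_of_pos hxpos]
    _ ≤ r * (ε' * ‖h‖) := by
        gcongr
        simpa only [Real.norm_eq_abs] using hMVT
    _ = ε' * ‖v‖ := by
        rw [hnh]; field_simp
    _ ≤ ε := by
        rw [hε'_def, div_mul_eq_mul_div, div_le_iff₀ hv1]
        nlinarith [norm_nonneg v]

/-- **Gradient lower bound from Euler's identity.** On the unit sup-sphere,
`ξ(u) = Dξ(u)·u = ∑ᵢ uᵢ ∂ᵢξ(u) ≤ ∑ᵢ |∂ᵢξ(u)|`. [folklore] -/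
theorem self_le_sum_abs_partial {ξ : (Fin d → ℝ) → ℝ}
    (hhom : ∀ c : ℝ, 0 < c → ∀ x, ξ (c • x) = c * ξ x)
    {u : Fin d → ℝ} (hu : ‖u‖ = 1) (hdiff : DifferentiableAt ℝ ξ u) :
    ξ u ≤ ∑ i : Fin d, |fderiv ℝ ξ u (Pi.single i 1)| := by
  have heuler := fderiv_apply_self_of_homogeneous hhom hdiff
  have hbasis : ∀ i : Fin d, (fun j : Fin d => if i = j then (1 : ℝ) else 0) = Pi.single i 1 := by
    intro i
    funext j
    simp [Pi.single_apply, eq_comm]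
  have hexp : u = ∑ i : Fin d, u i • (Pi.single i (1 : ℝ) : Fin d → ℝ) := by
    conv_lhs => rw [pi_eq_sum_univ u]
    simp only [hbasis]
  have hD : fderiv ℝ ξ u u = ∑ i : Fin d, u i * fderiv ℝ ξ u (Pi.single i 1) := by
    have h1 : fderiv ℝ ξ u u = fderiv ℝ ξ u (∑ i : Fin d, u i • (Pi.single i (1 : ℝ) : Fin d → ℝ)) :=
      congrArg (fderiv ℝ ξ u) hexp
    rw [h1, map_sum]
    simp only [map_smul, smul_eq_mul]
  rw [← heuler, hD]
  refine Finset.sum_le_sum fun i _ => ?_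
  have hui : |u i| ≤ 1 := by
    have h := norm_le_pi_norm u i
    rw [Real.norm_eq_abs, hu] at h
    exact h
  calc u i * fderiv ℝ ξ u (Pi.single i 1)
      ≤ |u i * fderiv ℝ ξ u (Pi.single i 1)| := le_abs_self _
    _ = |u i| * |fderiv ℝ ξ u (Pi.single i 1)| := abs_mul _ _
    _ ≤ 1 * |fderiv ℝ ξ u (Pi.single i 1)| := by gcongr
    _ = |fderiv ℝ ξ u (Pi.single i 1)| := one_mul _

/-! ### The hyperbolic-cosine gain of the lattice stencil -/

/-- Summing over the `2d` lattice directions: `∑ᵢ (e^{aᵢ} + e^{-aᵢ}) ≥ 2d + (∑ᵢ |aᵢ|)²/(2d)`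
(Cauchy–Schwarz). [folklore] -/
theorem stencil_gain (hd : 0 < d) (a : Fin d → ℝ) :
    2 * d + (∑ i : Fin d, |a i|) ^ 2 / (2 * d) ≤
      ∑ i : Fin d, (Real.exp (a i) + Real.exp (-(a i))) := by
  -- the hyperbolic-cosine gain `e^t + e^{-t} ≥ 2 + t²/2` (from `1 + t + t²/2 ≤ e^t`, `t ≥ 0`)
  have hcosh : ∀ t : ℝ, 2 + t ^ 2 / 2 ≤ Real.exp t + Real.exp (-t) := by
    intro t
    rcases le_total 0 t with ht | ht
    · have h1 := Real.quadratic_le_exp_of_nonneg ht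
      have h2 := Real.add_one_le_exp (-t)
      linarith
    · have ht' : 0 ≤ -t := by linarith
      have h1 := Real.quadratic_le_exp_of_nonneg ht'
      have h2 := Real.add_one_le_exp t
      have h3 : (-t) ^ 2 = t ^ 2 := by ring
      rw [h3] at h1
      linarith
  have hcs : (∑ i : Fin d, |a i|) ^ 2 ≤ d * ∑ i : Fin d, |a i| ^ 2 := by
    have h := sq_sum_le_card_mul_sum_sq (s := (Finset.univ : Finset (Fin d))) (f := fun i => |a i|)
    simpa using h
  have hsum : ∑ i : Fin d, (2 + (a i) ^ 2 / 2) ≤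
      ∑ i : Fin d, (Real.exp (a i) + Real.exp (-(a i))) :=
    Finset.sum_le_sum fun i _ => hcosh (a i)
  have hsum' : ∑ i : Fin d, (2 + (a i) ^ 2 / 2) = 2 * d + (∑ i : Fin d, |a i| ^ 2) / 2 := by
    rw [Finset.sum_add_distrib, Finset.sum_const, Finset.card_univ, Fintype.card_fin,
      ← Finset.sum_div]
    simp [sq_abs, nsmul_eq_mul]
    ring
  have hdpos : (0 : ℝ) < d := by exact_mod_cast hd
  have hkey : (∑ i : Fin d, |a i|) ^ 2 / (2 * d) ≤ (∑ i : Fin d, |a i| ^ 2) / 2 := by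
    rw [div_le_div_iff₀ (by positivity) (by norm_num)]
    nlinarith
  linarith

/-! ### The pointwise inequality chain -/

/-- The per-site algebra of the main theorem: given the eventual two-sided OZ bounds at `x` and at
its `2d` neighbours (tolerance `ε`), the prefactor ratios, the linearised exponents and the gradient
lower bound `∑ᵢ|aᵢ| ≥ m`, the stencil inequality `(2d + c)·G(x) ≤ ∑ (G(x+eᵢ) + G(x−eᵢ))` holds with
`c = m²/(4d)` once `ε = c/(8d + 8c)`. [folklore] -/
theorem stencil_chain (hd : 0 < d) {m c ε s Hx Gx : ℝ}
    {Gp Gm Hp Hm ξp ξm a : Fin d → ℝ}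
    (hm : 0 < m) (hc : c = m ^ 2 / (4 * d)) (hε : ε * (8 * d + 8 * c) = c)
    (hHx : 0 < Hx) (hG : Gx ≤ (1 + ε) * (Hx * Real.exp (-s)))
    (hGp : ∀ i, (1 - ε) * (Hp i * Real.exp (-(ξp i))) ≤ Gp i)
    (hGm : ∀ i, (1 - ε) * (Hm i * Real.exp (-(ξm i))) ≤ Gm i)
    (hHp : ∀ i, (1 - ε) * Hx ≤ Hp i) (hHm : ∀ i, (1 - ε) * Hx ≤ Hm i)
    (hξp : ∀ i, ξp i ≤ s + a i + ε) (hξm : ∀ i, ξm i ≤ s - a i + ε)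
    (ha : m ≤ ∑ i : Fin d, |a i|) :
    (2 * d + c) * Gx ≤ ∑ i : Fin d, (Gp i + Gm i) := by
  have hdpos : (0 : ℝ) < d := by exact_mod_cast hd
  have hcpos : 0 < c := by rw [hc]; positivity
  have hεpos : 0 < ε := by
    by_contra hneg
    push Not at hneg
    have : ε * (8 * d + 8 * c) ≤ 0 := mul_nonpos_of_nonpos_of_nonneg hneg (by positivity)
    linarith
  have hε1 : ε ≤ 1 / 8 := by
    -- ε = c/(8d+8c) ≤ c/(8c) = 1/8
    by_contra hlt
    push Not at hlt
    have : (1 / 8) * (8 * d + 8 * c) < ε * (8 * d + 8 * c) :=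
      mul_lt_mul_of_pos_right hlt (by positivity)
    nlinarith
  set W : ℝ := Hx * Real.exp (-s) with hW
  have hWpos : 0 < W := mul_pos hHx (Real.exp_pos _)
  -- (I) lower bound for each pair of opposite neighbours
  have hpair : ∀ i, (1 - ε) ^ 2 * Real.exp (-ε) * W * (Real.exp (a i) + Real.exp (-(a i)))
      ≤ Gp i + Gm i := by
    intro i
    have h1ε : 0 ≤ 1 - ε := by linarith
    -- exponent comparisons
    have hep : Real.exp (-(s + a i + ε)) ≤ Real.exp (-(ξp i)) :=
      Real.exp_le_exp.2 (by linarith [hξp i])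
    have hem : Real.exp (-(s - a i + ε)) ≤ Real.exp (-(ξm i)) :=
      Real.exp_le_exp.2 (by linarith [hξm i])
    have hGp' : (1 - ε) * ((1 - ε) * Hx * Real.exp (-(s + a i + ε))) ≤ Gp i := by
      refine le_trans ?_ (hGp i)
      refine mul_le_mul_of_nonneg_left ?_ h1ε
      exact mul_le_mul (hHp i) hep (Real.exp_pos _).le
        (le_trans (by positivity) (hHp i))
    have hGm' : (1 - ε) * ((1 - ε) * Hx * Real.exp (-(s - a i + ε))) ≤ Gm i := by
      refine le_trans ?_ (hGm i)
      refine mul_le_mul_of_nonneg_left ?_ h1ε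
      exact mul_le_mul (hHm i) hem (Real.exp_pos _).le
        (le_trans (by positivity) (hHm i))
    have hexp1 : Real.exp (-(s + a i + ε)) = Real.exp (-s) * Real.exp (-ε) * Real.exp (-(a i)) := by
      rw [← Real.exp_add, ← Real.exp_add]; ring_nf
    have hexp2 : Real.exp (-(s - a i + ε)) = Real.exp (-s) * Real.exp (-ε) * Real.exp (a i) := by
      rw [← Real.exp_add, ← Real.exp_add]; ring_nf
    rw [hexp1] at hGp'
    rw [hexp2] at hGm'
    have hsum := add_le_add hGp' hGm'
    have hrw : (1 - ε) * ((1 - ε) * Hx * (Real.exp (-s) * Real.exp (-ε) * Real.exp (-(a i)))) +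
        (1 - ε) * ((1 - ε) * Hx * (Real.exp (-s) * Real.exp (-ε) * Real.exp (a i))) =
        (1 - ε) ^ 2 * Real.exp (-ε) * W * (Real.exp (a i) + Real.exp (-(a i))) := by
      rw [hW]; ring
    linarith
  -- sum (I) over the directions and use the stencil gain
  have hI : (1 - ε) ^ 2 * Real.exp (-ε) * W * (2 * d + m ^ 2 / (2 * d)) ≤
      ∑ i : Fin d, (Gp i + Gm i) := by
    have hgain := stencil_gain hd a
    have hm2 : m ^ 2 / (2 * d) ≤ (∑ i : Fin d, |a i|) ^ 2 / (2 * d) := by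
      gcongr
    have hcoef : 0 ≤ (1 - ε) ^ 2 * Real.exp (-ε) * W := by positivity
    calc (1 - ε) ^ 2 * Real.exp (-ε) * W * (2 * d + m ^ 2 / (2 * d))
        ≤ (1 - ε) ^ 2 * Real.exp (-ε) * W *
            ∑ i : Fin d, (Real.exp (a i) + Real.exp (-(a i))) := by
          refine mul_le_mul_of_nonneg_left ?_ hcoef
          linarith
      _ = ∑ i : Fin d, (1 - ε) ^ 2 * Real.exp (-ε) * W * (Real.exp (a i) + Real.exp (-(a i))) := by
          rw [Finset.mul_sum]
      _ ≤ ∑ i : Fin d, (Gp i + Gm i) := Finset.sum_le_sum fun i _ => hpair i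
  -- (III) the numerical inequality between the constants
  have hIII : (2 * d + c) * (1 + ε) ≤ (1 - ε) ^ 2 * Real.exp (-ε) * (2 * d + m ^ 2 / (2 * d)) := by
    have hm2c : m ^ 2 / (2 * d) = 2 * c := by
      rw [hc]; field_simp; ring
    rw [hm2c]
    have hexpε : 1 - ε ≤ Real.exp (-ε) := by linarith [Real.add_one_le_exp (-ε)]
    have h1ε : 0 ≤ 1 - ε := by linarith
    have hcube : (1 - ε) ^ 3 * (2 * d + 2 * c) ≤ (1 - ε) ^ 2 * Real.exp (-ε) * (2 * d + 2 * c) := by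
      have : (1 - ε) ^ 3 = (1 - ε) ^ 2 * (1 - ε) := by ring
      rw [this]
      gcongr
    have hlin : (2 * d + c) * (1 + ε) ≤ (1 - 3 * ε) * (2 * d + 2 * c) := by nlinarith
    have hcub2 : (1 - 3 * ε) * (2 * d + 2 * c) ≤ (1 - ε) ^ 3 * (2 * d + 2 * c) := by
      have : 1 - 3 * ε ≤ (1 - ε) ^ 3 := by nlinarith [sq_nonneg ε]
      exact mul_le_mul_of_nonneg_right this (by positivity)
    linarith
  -- (II) and conclusion
  have hcoef2 : 0 ≤ 2 * (d : ℝ) + c := by positivity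
  calc (2 * d + c) * Gx ≤ (2 * d + c) * ((1 + ε) * W) := by
        exact mul_le_mul_of_nonneg_left hG hcoef2
    _ = (2 * d + c) * (1 + ε) * W := by ring
    _ ≤ (1 - ε) ^ 2 * Real.exp (-ε) * (2 * d + m ^ 2 / (2 * d)) * W :=
        mul_le_mul_of_nonneg_right hIII hWpos.le
    _ = (1 - ε) ^ 2 * Real.exp (-ε) * W * (2 * d + m ^ 2 / (2 * d)) := by ring
    _ ≤ ∑ i : Fin d, (Gp i + Gm i) := hI

/-- One-line form of the uniform linearisation (registered sub-goal of stmt-CriticalPhenomena-1341):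
for `ξ` positively `1`-homogeneous and `C¹` off the origin, `ξ(x+v) − ξ(x) − Dξ(x̂)v → 0` uniformly
as `‖x‖ → ∞`. [folklore] -/
theorem linearisation' : ∀ {d : ℕ} {ξ : (Fin d → ℝ) → ℝ}, (∀ c : ℝ, 0 < c → ∀ x, ξ (c • x) = c * ξ x) → ContDiffOn ℝ 1 ξ {0}ᶜ → ∀ (v : Fin d → ℝ) {ε : ℝ}, 0 < ε → ∃ R : ℝ, 0 < R ∧ ∀ x : Fin d → ℝ, R ≤ ‖x‖ → |ξ (x + v) - ξ x - fderiv ℝ ξ (‖x‖⁻¹ • x) v| ≤ ε :=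
  fun hhom hC1 v _ hε => linearisation hhom hC1 v hε

end Summit.CriticalPhenomena.Ising3DConformalLimit.Theorems.PerfectScreening.OZSubharmonic
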